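import Summits.HodgeConjecture.HodgeConjecture.Theorems.Ring2WeilCoverageCMFieldNormDescent
import Mathlib.Tactic.ComputeDegree
import HarnessLib

/-!
# Non-split Weil-type components over quartic CM fields, II: criteria WITHOUT an Eisenstein prime
# (biquadratic `V₄` fields) and at primes SPLIT in `F` (both places inert in `E/F`)

research route conditional on HC_CM; not a corollary; Q11.4-sentence-2 already refuted in dim ≥ 3.
Cell `pub-hodge-ring2`, seat `ring2-b03` (gen 47); kernel certificates for the Weil-type family-coverage
census `HOME/WEIL-FAMILY-COVERAGE.md` §b03.5 (operator priority5 2026-08-22T11:46:08Z). Companion of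
`Theorems/Ring2WeilCoverageCMFieldNormDescent.lean` (gen 46), whose generic certificate
`mk_prime_mul_ne_splitDiscriminantClassCM` needs (a) both carrier polynomials of Deligne's
`R = S² + pS + q` irreducible over `ℚ` and (b) joint anisotropy `haniso` of the two coordinate forms of the
norm form `a² - σb²` modulo a prime `ℓ`. Gen 46 supplied (a) by Eisenstein's criterion and (b) by `decide`
at a prime `ℓ` INERT in `F` and in `E/F` — which covers the two CYCLIC fields of the census (`ℚ(ζ₅)`,
`ℚ(√-(2+√2))`) and no biquadratic one: a `V₄` quartic `T⁴ + pT² + q` is reducible modulo every prime (no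
Eisenstein prime, no inert prime of residue degree 4). This file removes both restrictions:

* §1 **irreducibility by factor exclusion** (generic in `p, q ∈ ℚ`; the route of
  `WeilTypeLadderCyclicPrymTwentyBiquadratic.quarticTwentyGolden_irreducible_rat` for `T⁴ + 3T² + 1`):
  `S² + pS + q` is irreducible over `ℚ` when `p² - 4q` is not a rational square, and so is `T⁴ + pT² + q` when
  moreover `2b - p` is not a rational square for `b² = q` (automatic for `0 < p`, `4q < p²`, i.e. for every
  totally negative generator `η²` of a quartic CM field: `p = -Tr η² > 0`, `p² - 4q = disc > 0`);
* §2 the resulting `Fact (Irreducible (realPolyQ R))` / `Fact (Irreducible (cmPolyQ R))` for Deligne's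
  carriers (`Deligne1982/WeilTypeCMDiscriminant`), for ANY `R = S² + pS + q` of that shape;
* §3 **joint anisotropy from two roots**: if `R` has two distinct roots `k₁ ≠ k₂` in `𝔽_ℓ` (`ℓ` SPLIT in `F`)
  which are both non-squares (both places of `F` over `ℓ` INERT in `E = F(η)`, `η² = σ`), then the two
  coordinate forms vanish mod `ℓ` only at the origin — evaluate `(a + bσ)² - σ(c + dσ)² = X + Yσ + R(σ)·G`
  at `σ = k₁, k₂`;
* §4 the packaged certificate **`mk_prime_mul_ne_splitDiscriminantClassCM_of_two_roots`**: `[ℓw] ≠ [1]` in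
  `F^×/Nm_{E/F}(E^×)` for `ℓ ∤ w` — the census rows `W8.E.δ` whose `T(δ)` is the PAIR of places over one
  rational prime `ℓ` (e.g. `ℚ(ζ₈)`: `[7]`, `[23]`; `ℚ(ζ₁₂)`: `[11]`, `[23]`; `ℚ(√-3,√5)`: `[11]`, `[29]`;
  `ℚ(i,√5)`: `[11]`, `[19]`; `ℚ(ζ₅)`: `[19]`) are NON-SPLIT components (Deligne Cor. 4.2: no `E`-Lagrangian),
  instances in the companion file `Ring2WeilCoverageCMFieldCriteriaInstances.lean`.

No named fact, no definition, no `sorry`; nothing about the Hodge conjecture is asserted.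
References: [Deligne1982HodgeCycles] §4 p. 30 (1), Cor. 4.2, Lemma 4.6; [Landherr1936HermitianForms]. -/

noncomputable section

set_option linter.dupNamespace false

open Polynomial

namespace Summit.HodgeConjecture.HodgeConjecture.Ring2.WeilCoverageCM

open Literature.AlgebraicGeometry.Deligne1982
open Literature.AlgebraicGeometry.HodgeTheory (splitDiscriminantClassCM)

/-! ### §1 Irreducibility over `ℚ` by factor exclusion -/

/-- A rational square is never a prime times a non-zero rational square (`√ℓ ∉ ℚ`). [folklore] -/
theorem rat_sq_ne_prime_mul_sq {ℓ : ℕ} (hℓ : ℓ.Prime) {m : ℚ} (hm : m ≠ 0) (r : ℚ) :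
    r ^ 2 ≠ ℓ * m ^ 2 := by
  intro h
  have hsq : IsSquare ((ℓ : ℕ) : ℚ) := ⟨r / m, by field_simp; linear_combination -h⟩
  exact hℓ.prime.not_isSquare (Rat.isSquare_natCast_iff.1 hsq)

/-- **`S² + pS + q` is irreducible over `ℚ` when `p² - 4q` is not a rational square**: a monic factor of
degree `1` is a rational root `x`, and then `(2x + p)² = p² - 4q`. [folklore] -/
theorem irreducible_quadratic_of_not_sq (p q : ℚ) (hD : ∀ r : ℚ, r ^ 2 ≠ p ^ 2 - 4 * q) :
    Irreducible (X ^ 2 + C p * X + C q : Polynomial ℚ) := by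
  have hm : (X ^ 2 + C p * X + C q : Polynomial ℚ).Monic := by monicity!
  have hdeg : (X ^ 2 + C p * X + C q : Polynomial ℚ).natDegree = 2 := by compute_degree!
  have hne1 : (X ^ 2 + C p * X + C q : Polynomial ℚ) ≠ 1 := by
    intro h; have := congrArg Polynomial.natDegree h; rw [hdeg] at this; simp at this
  rw [hm.irreducible_iff_lt_natDegree_lt hne1]
  intro g hg hgdeg
  rw [hdeg, Finset.mem_Ioc] at hgdeg
  rintro ⟨r, hr⟩
  have hev : ∀ x : ℚ, x ^ 2 + p * x + q = Polynomial.eval x g * Polynomial.eval x r := by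
    intro x
    have := congrArg (Polynomial.eval x) hr
    simpa [Polynomial.eval_mul] using this
  have hg1 : g.natDegree = 1 := by omega
  set x0 := g.coeff 0 with hx0
  have hgf : g = X + C x0 := hg.eq_X_add_C hg1
  have h0 := hev (-x0)
  rw [hgf, Polynomial.eval_add, Polynomial.eval_X, Polynomial.eval_C, neg_add_cancel, zero_mul] at h0
  exact hD (2 * (-x0) + p) (by linear_combination 4 * h0)

/-- **`T⁴ + pT² + q` is irreducible over `ℚ`** as soon as `p² - 4q` is not a rational square and `2b - p` is
not a rational square whenever `b² = q` — by EXCLUSION OF FACTORS (a `V₄` quartic is reducible modulo every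
prime and admits no Eisenstein prime, so no reduction criterion applies): a monic factor of degree `1` is a
rational root `x`, and then `(2x² + p)² = p² - 4q`; a monic factor `T² + aT + b` with cofactor `T² + cT + d`
gives (values at `0, ±1, ±2`) `a + c = 0`, `ad + bc = 0`, `b + d + ac = p`, `bd = q`, whence `a = 0` and
`(b - d)² = p² - 4q`, or `d = b`, `b² = q`, `a² = 2b - p`. [folklore] -/
theorem irreducible_quartic_of_not_sq (p q : ℚ) (hD : ∀ r : ℚ, r ^ 2 ≠ p ^ 2 - 4 * q)
    (h2 : ∀ a b : ℚ, b ^ 2 = q → a ^ 2 ≠ 2 * b - p) :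
    Irreducible (X ^ 4 + C p * X ^ 2 + C q : Polynomial ℚ) := by
  have hm : (X ^ 4 + C p * X ^ 2 + C q : Polynomial ℚ).Monic := by monicity!
  have hdeg : (X ^ 4 + C p * X ^ 2 + C q : Polynomial ℚ).natDegree = 4 := by compute_degree!
  have hne1 : (X ^ 4 + C p * X ^ 2 + C q : Polynomial ℚ) ≠ 1 := by
    intro h; have := congrArg Polynomial.natDegree h; rw [hdeg] at this; simp at this
  rw [hm.irreducible_iff_lt_natDegree_lt hne1]
  intro g hg hgdeg
  rw [hdeg, Finset.mem_Ioc] at hgdeg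
  rintro ⟨r, hr⟩
  have hrm : r.Monic := Polynomial.Monic.of_mul_monic_left hg (hr ▸ hm)
  have hsum : g.natDegree + r.natDegree = 4 := by
    rw [← Polynomial.Monic.natDegree_mul hg hrm, ← hr, hdeg]
  have hev : ∀ x : ℚ, x ^ 4 + p * x ^ 2 + q = Polynomial.eval x g * Polynomial.eval x r := by
    intro x
    have := congrArg (Polynomial.eval x) hr
    simpa [Polynomial.eval_mul] using this
  rcases Nat.lt_or_ge g.natDegree 2 with h1 | h2'
  · -- degree 1: a rational root `x0`, `(2x0² + p)² = p² - 4q`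
    have hg1 : g.natDegree = 1 := by omega
    set x0 := g.coeff 0 with hx0
    have hgf : g = X + C x0 := hg.eq_X_add_C hg1
    have h0 := hev (-x0)
    rw [hgf, Polynomial.eval_add, Polynomial.eval_X, Polynomial.eval_C, neg_add_cancel, zero_mul] at h0
    exact hD (2 * (-x0) ^ 2 + p) (by linear_combination 4 * h0)
  · -- degree 2: a rational quadratic factor
    have hg2 : g.natDegree = 2 := by omega
    have hr2 : r.natDegree = 2 := by omega
    set a := g.coeff 1 with ha
    set b := g.coeff 0 with hb
    set c := r.coeff 1 with hc
    set d := r.coeff 0 with hd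
    have hgf : g = X ^ 2 + C a * X + C b := by
      have := hg.as_sum; rw [hg2] at this; rw [this]
      simp only [Finset.sum_range_succ, Finset.sum_range_zero, zero_add, pow_zero, mul_one, pow_one]; ring
    have hrf : r = X ^ 2 + C c * X + C d := by
      have := hrm.as_sum; rw [hr2] at this; rw [this]
      simp only [Finset.sum_range_succ, Finset.sum_range_zero, zero_add, pow_zero, mul_one, pow_one]; ring
    have hev' : ∀ x : ℚ, x ^ 4 + p * x ^ 2 + q = (x ^ 2 + a * x + b) * (x ^ 2 + c * x + d) := by
      intro x; have := hev x; rw [hgf, hrf] at this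
      simpa [Polynomial.eval_add, Polynomial.eval_mul, Polynomial.eval_pow, Polynomial.eval_X,
        Polynomial.eval_C] using this
    have e0 := hev' 0
    have e1 := hev' 1
    have em1 := hev' (-1)
    have e2 := hev' 2
    have em2 := hev' (-2)
    have hA3 : a + c = 0 := by linear_combination (-(e2 - em2) + 2 * (e1 - em1)) / 12
    have hA1 : a * d + b * c = 0 := by
      linear_combination (-(e1 - em1)) / 2 - (-(e2 - em2) + 2 * (e1 - em1)) / 12
    have hA0 : b * d = q := by linear_combination -e0
    have hA2 : b + d + a * c = p := by linear_combination (-(e1 + em1)) / 2 + e0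
    have hc' : c = -a := by linear_combination hA3
    rw [hc'] at hA1 hA2
    have had : a * (d - b) = 0 := by linear_combination hA1
    rcases mul_eq_zero.1 had with h0 | hdb
    · -- `a = 0`: `(b - d)² = p² - 4q`
      rw [h0] at hA2
      have hbd : b + d = p := by linear_combination hA2
      exact hD (b - d) (by linear_combination (b + d + p) * hbd - 4 * hA0)
    · -- `d = b`: `b² = q` and `a² = 2b - p`
      have hdb' : d = b := by linear_combination hdb
      rw [hdb'] at hA0 hA2
      exact h2 a b (by linear_combination hA0) (by linear_combination -hA2)

/-- The CM case: for `0 < p` and `4q < p²` (a real quadratic `F = ℚ[S]/(S² + pS + q)` and a totally negative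
`σ`, as for every census carrier) the side condition `a² ≠ 2b - p` of `irreducible_quartic_of_not_sq` is
automatic (`2b ≤ 2√q < p`). [folklore] -/
theorem irreducible_quartic_of_pos (p q : ℚ) (hp : 0 < p) (h4 : 4 * q < p ^ 2)
    (hD : ∀ r : ℚ, r ^ 2 ≠ p ^ 2 - 4 * q) :
    Irreducible (X ^ 4 + C p * X ^ 2 + C q : Polynomial ℚ) := by
  refine irreducible_quartic_of_not_sq p q hD fun a b hb ha => ?_
  nlinarith [sq_nonneg a, sq_nonneg (2 * b - p), sq_nonneg (2 * b + p)]

/-! ### §2 The `Fact`s for Deligne's carriers `F = realField R`, `E = cmField R`, `R = S² + pS + q` -/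

section Facts

variable {p q : ℤ} {R : Polynomial ℤ}

/-- `cmPolyQ (S² + pS + q) = T⁴ + pT² + q ∈ ℚ[T]`, instance-free (usable BEFORE `F`, `E` are known to be
fields; `realPolyQ_quadratic` of the companion file is stated under the `Fact`). [cite: Deligne1982HodgeCycles, §4 p. 30] -/
theorem cmPolyQ_eq_of_quadratic (hR : R = X ^ 2 + C p * X + C q) :
    cmPolyQ R = X ^ 4 + C (p : ℚ) * X ^ 2 + C (q : ℚ) := by
  have e : realPolyQ R = X ^ 2 + C (p : ℚ) * X + C (q : ℚ) := by
    subst hR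
    show Polynomial.map (Int.castRingHom ℚ) (X ^ 2 + C p * X + C q) = _
    rw [Polynomial.map_add, Polynomial.map_add, Polynomial.map_mul, Polynomial.map_pow, map_X, map_C, map_C,
      eq_intCast, eq_intCast]
  rw [cmPolyQ_eq_comp, e]
  simp only [add_comp, mul_comp, pow_comp, X_comp, C_comp]
  ring

/-- **`F = ℚ[S]/(S² + pS + q)` is a field** when `p² - 4q` is not a rational square.
[cite: Deligne1982HodgeCycles, §4 p. 30] -/
theorem fact_irreducible_realPolyQ_of_not_sq (hR : R = X ^ 2 + C p * X + C q)
    (hD : ∀ r : ℚ, r ^ 2 ≠ (p : ℚ) ^ 2 - 4 * q) : Fact (Irreducible (realPolyQ R)) := by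
  -- `realPolyQ R = S² + pS + q` (the computation of `realPolyQ_quadratic`, which is stated under the `Fact`)
  have e : realPolyQ R = X ^ 2 + C (p : ℚ) * X + C (q : ℚ) := by
    subst hR
    show Polynomial.map (Int.castRingHom ℚ) (X ^ 2 + C p * X + C q) = _
    rw [Polynomial.map_add, Polynomial.map_add, Polynomial.map_mul, Polynomial.map_pow, map_X, map_C, map_C,
      eq_intCast, eq_intCast]
  rw [e]
  exact ⟨irreducible_quadratic_of_not_sq _ _ hD⟩

/-- **`E = ℚ[T]/(T⁴ + pT² + q)` is a field** when `p² - 4q` is not a rational square and `a² ≠ 2b - p` for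
`b² = q`. [cite: Deligne1982HodgeCycles, §4 p. 30] -/
theorem fact_irreducible_cmPolyQ_of_not_sq (hR : R = X ^ 2 + C p * X + C q)
    (hD : ∀ r : ℚ, r ^ 2 ≠ (p : ℚ) ^ 2 - 4 * q) (h2 : ∀ a b : ℚ, b ^ 2 = q → a ^ 2 ≠ 2 * b - p) :
    Fact (Irreducible (cmPolyQ R)) := by
  rw [cmPolyQ_eq_of_quadratic hR]
  exact ⟨irreducible_quartic_of_not_sq _ _ hD h2⟩

/-- **`E = ℚ[T]/(T⁴ + pT² + q)` is a field** in the CM regime `0 < p`, `4q < p²`, `p² - 4q` not a rational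
square (every quartic CM carrier of the census). [cite: Deligne1982HodgeCycles, §4 p. 30] -/
theorem fact_irreducible_cmPolyQ_of_pos (hR : R = X ^ 2 + C p * X + C q) (hp : 0 < p) (h4 : 4 * q < p ^ 2)
    (hD : ∀ r : ℚ, r ^ 2 ≠ (p : ℚ) ^ 2 - 4 * q) : Fact (Irreducible (cmPolyQ R)) := by
  rw [cmPolyQ_eq_of_quadratic hR]
  exact ⟨irreducible_quartic_of_pos _ _ (by exact_mod_cast hp) (by exact_mod_cast h4) hD⟩

end Facts

/-! ### §3 Joint anisotropy of the two coordinate forms from two roots of `R` mod `ℓ` -/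

/-- **Anisotropy at a prime SPLIT in `F` with both places INERT in `E/F`.** If `R = S² + pS + q` has roots
`k₁ ≠ k₂` in `𝔽_ℓ`, neither a square, then the coordinate forms
`X = a² - qb² + 2qcd - pqd²`, `Y = 2ab - pb² - c² + 2pcd - (p² - q)d²` of `(a + bσ)² - σ(c + dσ)²` vanish
mod `ℓ` only at `a = b = c = d = 0`: `(a + bkᵢ)² - kᵢ(c + dkᵢ)² = X + kᵢY + R(kᵢ)(b² - 2cd + pd² - kᵢd²)`, so
`a + bkᵢ = c + dkᵢ = 0` for `i = 1, 2`. [folklore] -/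
theorem aniso_of_two_roots (p q : ℤ) (ℓ : ℕ) (hℓ : ℓ.Prime) (k₁ k₂ : ZMod ℓ)
    (hk₁ : k₁ ^ 2 + (p : ZMod ℓ) * k₁ + (q : ZMod ℓ) = 0) (hk₂ : k₂ ^ 2 + (p : ZMod ℓ) * k₂ + (q : ZMod ℓ) = 0)
    (hne : k₁ ≠ k₂) (hns₁ : ∀ r : ZMod ℓ, r ^ 2 ≠ k₁) (hns₂ : ∀ r : ZMod ℓ, r ^ 2 ≠ k₂) :
    ∀ a b c d : ZMod ℓ,
      a ^ 2 - (q : ZMod ℓ) * b ^ 2 + 2 * (q : ZMod ℓ) * c * d - (p : ZMod ℓ) * (q : ZMod ℓ) * d ^ 2 = 0 →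
      2 * a * b - (p : ZMod ℓ) * b ^ 2 - c ^ 2 + 2 * (p : ZMod ℓ) * c * d
          - ((p : ZMod ℓ) ^ 2 - (q : ZMod ℓ)) * d ^ 2 = 0 →
        a = 0 ∧ b = 0 ∧ c = 0 ∧ d = 0 := by
  -- `ℓ.Prime` is an explicit hypothesis (not a `Fact` instance) so that the numeric side conditions can be
  -- discharged by `decide` at the call sites (a local `Fact` instance would enter the decided proposition)
  haveI : Fact ℓ.Prime := ⟨hℓ⟩
  intro a b c d hX hY
  -- the norm form at the two roots
  have hval : ∀ k : ZMod ℓ, k ^ 2 + (p : ZMod ℓ) * k + (q : ZMod ℓ) = 0 →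
      (a + b * k) ^ 2 - k * (c + d * k) ^ 2 = 0 := by
    intro k hk
    linear_combination hX + k * hY + (b ^ 2 - 2 * c * d + (p : ZMod ℓ) * d ^ 2 - k * d ^ 2) * hk
  -- `u² = k v²` with `k` a non-square forces `u = v = 0`
  have hzero : ∀ k : ZMod ℓ, (∀ r : ZMod ℓ, r ^ 2 ≠ k) → ∀ u v : ZMod ℓ,
      u ^ 2 - k * v ^ 2 = 0 → u = 0 ∧ v = 0 := by
    intro k hns u v h
    by_cases hv : v = 0
    · rw [hv] at h
      have hu : u ^ 2 = 0 := by linear_combination h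
      exact ⟨pow_eq_zero_iff (n := 2) (by norm_num) |>.1 hu, hv⟩
    · exfalso
      refine hns (u / v) ?_
      field_simp
      linear_combination h
  obtain ⟨hu₁, hv₁⟩ := hzero k₁ hns₁ _ _ (hval k₁ hk₁)
  obtain ⟨hu₂, hv₂⟩ := hzero k₂ hns₂ _ _ (hval k₂ hk₂)
  have hk : k₁ - k₂ ≠ 0 := sub_ne_zero.2 hne
  have hb : b = 0 := by
    have h : b * (k₁ - k₂) = 0 := by linear_combination hu₁ - hu₂
    exact (mul_eq_zero.1 h).resolve_right hk
  have hd : d = 0 := by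
    have h : d * (k₁ - k₂) = 0 := by linear_combination hv₁ - hv₂
    exact (mul_eq_zero.1 h).resolve_right hk
  refine ⟨by linear_combination hu₁ - k₁ * hb, hb, by linear_combination hv₁ - k₁ * hd, hd⟩

/-! ### §4 The packaged certificate at a split prime -/

/-- **Non-split criterion at a prime split in `F`, both places inert in `E/F`.** For `R = S² + pS + q` in
the CM regime (`0 < p`, `4q < p²`, `p² - 4q` not a rational square) and a prime `ℓ` at which `R` has two
distinct non-square roots mod `ℓ`: `[ℓw] ≠ [(-1)²] = [1]` in `F^×/Nm_{E/F}(E^×)` for `ℓ ∤ w` — the Weil-type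
component `(E, 4, [ℓw])` has no `E`-Lagrangian member. [cite: Deligne1982HodgeCycles, §4 p. 30 (1) and Cor. 4.2]
[cite: Landherr1936HermitianForms] -/
theorem mk_prime_mul_ne_splitDiscriminantClassCM_of_two_roots {p q : ℤ} {R : Polynomial ℤ}
    (hR : R = X ^ 2 + C p * X + C q) [Fact (Irreducible (realPolyQ R))]
    (hp : 0 < p) (h4 : 4 * q < p ^ 2) (hD : ∀ r : ℚ, r ^ 2 ≠ (p : ℚ) ^ 2 - 4 * q)
    (ℓ : ℕ) (hℓ : ℓ.Prime) (k₁ k₂ : ZMod ℓ)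
    (hk₁ : k₁ ^ 2 + (p : ZMod ℓ) * k₁ + (q : ZMod ℓ) = 0) (hk₂ : k₂ ^ 2 + (p : ZMod ℓ) * k₂ + (q : ZMod ℓ) = 0)
    (hne : k₁ ≠ k₂) (hns₁ : ∀ r : ZMod ℓ, r ^ 2 ≠ k₁) (hns₂ : ∀ r : ZMod ℓ, r ^ 2 ≠ k₂)
    (w : ℤ) (hw : ¬ (ℓ : ℤ) ∣ w) (u : (realField R)ˣ)
    (hu : (u : realField R) = AdjoinRoot.of (realPolyQ R) (ℓ * w)) :
    (QuotientGroup.mk u : cmNormResidueGroup R) ≠ splitDiscriminantClassCM R 2 := by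
  haveI : Fact ℓ.Prime := ⟨hℓ⟩
  haveI : Fact (Irreducible (cmPolyQ R)) := fact_irreducible_cmPolyQ_of_pos hR hp h4 hD
  exact mk_prime_mul_ne_splitDiscriminantClassCM hR ℓ
    (aniso_of_two_roots p q ℓ hℓ k₁ k₂ hk₁ hk₂ hne hns₁ hns₂) w hw u hu

end Summit.HodgeConjecture.HodgeConjecture.Ring2.WeilCoverageCM

end
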